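import Mathlib
import HarnessLib
import Summits.ResolutionOfSingularities.ResolutionOfSingularities.Theorems.WildQuotientsWildQuotientResolutionZ9PeeledTerminalLiftCube
import Summits.ResolutionOfSingularities.ResolutionOfSingularities.Theorems.WildQuotientsWildQuotientResolutionFixedPointsRegular
import Literature.AlgebraicGeometry.Resolution.FiniteQuotientSingularityPresentation

/-!
# ℤ9 SPECIMEN (peeled `𝔸⁴/ℤ9`, char 3), brick Z4b part 3: Király–Lütkebohmert on the TERMINAL chart ring —
# the augmentation ideal of `σ̃` is locally `(s³)`, so `L₂^{σ̃}` is a regular ring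

(crux stmt-ResolutionOfSingularities-15640 `WildQuotients.WildQuotientResolution`, line `Sketch`; S1 =
stmt-ResolutionOfSingularities-17941 `CyclicQuotientFourfolds`; chain w45c card-P specimen «peeled 𝔸⁴/ℤ9», variant
V-BR, brick Z4b (res-L1-w45c-idea-2 `Z9-SPECIMEN.md` §2 «x₂-chart … θ(w) ≡ 1 mod s — UNIT near E ⇒ KILL by the
passenger itself … the σ̄-quotient is REGULAR outright (K–L, r = 1)»; res-L1-w45c-plan-1 RULING 2026-08-27T18:23:36Z).
[OURS · L1 W4.5c] — NOT a statement of any manuscript; AI-produced, kernel-checked ≠ expert-reviewed. Def-free,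
LAW-BASED over the laws of `…Z9PeeledTerminalLift` (mould: res-L1-w45c-stub-2's Z4T `…Z9PeeledTwistedKL`).)

For ANY `k`-algebra automorphism `σ̃` of `L₂ = k[x][(v v')⁻¹]` with the terminal-lift laws (one exists with
`σ̃³ = 1`: `exists_terminalLift`):

* `C_cube_dvd_terminalLift_sub` — **`s³ ∣ σ̃ y − y` for every `y ∈ L₂`** (generators: `σ̃s − s = s⁴x_b′`,
  `σ̃x_a′ − x_a′ = −x_a′·s³x_b′·iv·(1 + iv + ⋯ + iv⁶)`, `σ̃x_b′ − x_b′ = s³(x_a′ iv⁴ − x_b′² iv (1 + iv + iv² + iv³))`,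
  `σ̃x_d − x_d = s³(1 − s¹²x_a′²)`, `σ̃J − J = s³·x_b′ J (v² + v + 1)`; then `k[x]` by induction and `L₂` by
  `y = ι r · Jᵐ`);
* **`terminalLift_map_augIdeal_isPrincipal`** — at EVERY prime `𝔮` of `L₂` the image of the augmentation ideal
  in `(L₂)_𝔮` is the principal ideal `(s³)`: one of `θ_d = 1 − s¹²x_a′²`, `s x_b′`, `x_a′iv⁴ − x_b′²iv(⋯)` is a unit
  at `𝔮` (if `θ_d ∈ 𝔮` then `s, x_a′ ∉ 𝔮`, and then `s x_b′` or — when `x_b′ ∈ 𝔮` — the `x_b′`-increment cofactor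
  is a unit);
* **`terminalLift_fixedPoints_isRegularRing`** — `L₂^{σ̃} = FixedPoints.subalgebra k L₂ (zpowers σ̃)` is REGULAR
  (tree K–L `TameTransfer.isRegularRing_fixedPoints_zpowers`, `p = 3`; `L₂` is a regular domain of finite type over
  `k` as a localisation of `k[x]`) — the V-BR chart datum of the terminal piece `P₂` (trivially graded); the seam
  `Γ(P₂) ≅ L₂` is part 4.
-/

-- single-problem summit: the doubled namespace component `ResolutionOfSingularities` is forced
set_option linter.dupNamespace false

noncomputable section

open MvPolynomial

namespace Summit.ResolutionOfSingularities.ResolutionOfSingularities.Theorems.WildQuotientResolution.Z9Peeled.Terminal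

variable (k : Type) [Field k] (n : ℕ) (a b c d : Fin n)

/-- `v = 1 + s³ x_b′` (slots `s = X c`, `x_b′ = X b`; local shorthand). -/
local notation3 "v₂" => (1 + X c ^ 3 * X b : MvPolynomial (Fin n) k)
/-- `v' = 1 − s³ x_b′ + s⁶ x_a′` (local shorthand). -/
local notation3 "v₂'" => (1 - X c ^ 3 * X b + X c ^ 6 * X a : MvPolynomial (Fin n) k)
/-- `u₂ = v v'` expanded (local shorthand; the element inverted on the terminal piece). -/
local notation3 "u₂" => ((1 + X c ^ 3 * X b) * (1 - X c ^ 3 * X b + X c ^ 6 * X a) : MvPolynomial (Fin n) k)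
/-- The terminal chart ring `L₂ = k[x][(v v')⁻¹]` (local shorthand). -/
local notation3 "L₂" => Localization.Away
  ((1 + X c ^ 3 * X b) * (1 - X c ^ 3 * X b + X c ^ 6 * X a) : MvPolynomial (Fin n) k)
/-- `ι : k[x] → L₂` (local shorthand). -/
local notation3 "ι₂" => algebraMap (MvPolynomial (Fin n) k) (Localization.Away
  ((1 + X c ^ 3 * X b) * (1 - X c ^ 3 * X b + X c ^ 6 * X a) : MvPolynomial (Fin n) k))
/-- `J = (v v')⁻¹ ∈ L₂` (local shorthand). -/
local notation3 "J₂" => (IsLocalization.Away.invSelf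
  ((1 + X c ^ 3 * X b) * (1 - X c ^ 3 * X b + X c ^ 6 * X a) : MvPolynomial (Fin n) k) :
  Localization.Away ((1 + X c ^ 3 * X b) * (1 - X c ^ 3 * X b + X c ^ 6 * X a) : MvPolynomial (Fin n) k))
/-- `iv = (ι v)⁻¹ = ι v' · J` (local shorthand). -/
local notation3 "iv₂" => (algebraMap (MvPolynomial (Fin n) k) (Localization.Away
  ((1 + X c ^ 3 * X b) * (1 - X c ^ 3 * X b + X c ^ 6 * X a) : MvPolynomial (Fin n) k))
    (1 - X c ^ 3 * X b + X c ^ 6 * X a) *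
  (IsLocalization.Away.invSelf
    ((1 + X c ^ 3 * X b) * (1 - X c ^ 3 * X b + X c ^ 6 * X a) : MvPolynomial (Fin n) k) :
    Localization.Away ((1 + X c ^ 3 * X b) * (1 - X c ^ 3 * X b + X c ^ 6 * X a) : MvPolynomial (Fin n) k)))
/-- `iv' = (ι v')⁻¹ = ι v · J` (local shorthand). -/
local notation3 "iv₂'" => (algebraMap (MvPolynomial (Fin n) k) (Localization.Away
  ((1 + X c ^ 3 * X b) * (1 - X c ^ 3 * X b + X c ^ 6 * X a) : MvPolynomial (Fin n) k))
    (1 + X c ^ 3 * X b) *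
  (IsLocalization.Away.invSelf
    ((1 + X c ^ 3 * X b) * (1 - X c ^ 3 * X b + X c ^ 6 * X a) : MvPolynomial (Fin n) k) :
    Localization.Away ((1 + X c ^ 3 * X b) * (1 - X c ^ 3 * X b + X c ^ 6 * X a) : MvPolynomial (Fin n) k)))
/-- The terminal substitution `ψ₂` (local shorthand): `x_a ↦ x_a′ s⁷`, `x_b ↦ x_b′ s⁴`, rest fixed. -/
local notation3 "tm₂" => (fun i : Fin n => if i = a then X a * X c ^ 7
    else if i = b then X b * X c ^ 4 else (X i : MvPolynomial (Fin n) k))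

/-! ## `s³` divides every increment -/

/-- `1 − iv = iv · s³ x_b′` (from `v · iv = 1`, `v = 1 + s³x_b′`). [folklore] -/
theorem one_sub_iv : 1 - iv₂ = iv₂ * (ι₂ (X c) ^ 3 * ι₂ (X b)) := by
  have hJ := algebraMap_v_mul_iv k n a b c
  have hV := algebraMap_v_eq k n a b c
  linear_combination (-1 : L₂) * hJ + iv₂ * hV

-- induction over `k[x]` plus the localisation bookkeeping; head-room
set_option maxHeartbeats 1600000 in
/-- **`s³ ∣ σ̃ y − y` for every `y ∈ L₂`** (char 3; see the module docstring for the generators).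
[OURS · L1 W4.5c] -/
theorem C_cube_dvd_terminalLift_sub [CharP k 3] (τ : L₂ →ₐ[k] L₂)
    (hC : τ (ι₂ (X c)) = ι₂ (X c * v₂)) (hA : τ (ι₂ (X a)) = ι₂ (X a) * iv₂ ^ 7)
    (hB : τ (ι₂ (X b)) = ι₂ (X b + X c ^ 3 * X a) * iv₂ ^ 4)
    (hD : τ (ι₂ (X d)) = ι₂ (X d + X c ^ 3 - X c ^ 15 * X a ^ 2))
    (hfix : ∀ i, i ≠ a → i ≠ b → i ≠ c → i ≠ d → τ (ι₂ (X i)) = ι₂ (X i)) (y : L₂) :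
    ι₂ (X c) ^ 3 ∣ τ y - y := by
  classical
  have hiv := one_sub_iv k n a b c
  have hV := algebraMap_v_eq k n a b c
  have hBA := algebraMap_bshift_eq k n a b c
  have h1 := algebraMap_u_mul_J k n a b c
  have hJτ := lift_apply_J k n a b c τ hC hA hB
  -- generators
  have dC : ι₂ (X c) ^ 3 ∣ τ (ι₂ (X c)) - ι₂ (X c) := by
    refine ⟨ι₂ (X c) * ι₂ (X b), ?_⟩
    rw [hC, map_mul, hV]; ring
  have dA : ι₂ (X c) ^ 3 ∣ τ (ι₂ (X a)) - ι₂ (X a) := by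
    refine ⟨-(ι₂ (X a) * ι₂ (X b) * iv₂ *
      (iv₂ ^ 6 + iv₂ ^ 5 + iv₂ ^ 4 + iv₂ ^ 3 + iv₂ ^ 2 + iv₂ + 1)), ?_⟩
    rw [hA]
    linear_combination (-(ι₂ (X a) * (iv₂ ^ 6 + iv₂ ^ 5 + iv₂ ^ 4 + iv₂ ^ 3 + iv₂ ^ 2 + iv₂ + 1))) * hiv
  have dB : ι₂ (X c) ^ 3 ∣ τ (ι₂ (X b)) - ι₂ (X b) := by
    refine ⟨ι₂ (X a) * iv₂ ^ 4 - ι₂ (X b) ^ 2 * iv₂ * (iv₂ ^ 3 + iv₂ ^ 2 + iv₂ + 1), ?_⟩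
    rw [hB, hBA]
    linear_combination (-(ι₂ (X b) * (iv₂ ^ 3 + iv₂ ^ 2 + iv₂ + 1))) * hiv
  have dD : ι₂ (X c) ^ 3 ∣ τ (ι₂ (X d)) - ι₂ (X d) := by
    refine ⟨1 - ι₂ (X c) ^ 12 * ι₂ (X a) ^ 2, ?_⟩
    rw [hD, map_sub (algebraMap _ _), map_add (algebraMap _ _)]
    simp only [map_mul, map_pow]
    ring
  have dJ : ι₂ (X c) ^ 3 ∣ τ J₂ - J₂ := by
    refine ⟨ι₂ (X b) * J₂ * (ι₂ v₂ ^ 2 + ι₂ v₂ + 1), ?_⟩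
    rw [hJτ]
    linear_combination (J₂ * (ι₂ v₂ ^ 2 + ι₂ v₂ + 1)) * hV
  -- all variables
  have dX : ∀ i : Fin n, ι₂ (X c) ^ 3 ∣ τ (ι₂ (X i)) - ι₂ (X i) := by
    intro i
    by_cases hia : i = a
    · rw [hia]; exact dA
    by_cases hib : i = b
    · rw [hib]; exact dB
    by_cases hic : i = c
    · rw [hic]; exact dC
    by_cases hid : i = d
    · rw [hid]; exact dD
    · rw [hfix i hia hib hic hid, sub_self]; exact dvd_zero _
  -- `k[x]`
  have dP : ∀ r : MvPolynomial (Fin n) k, ι₂ (X c) ^ 3 ∣ τ (ι₂ r) - ι₂ r := by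
    intro r
    induction r using MvPolynomial.induction_on with
    | C r =>
      have h : ι₂ (C r) = algebraMap k L₂ r := by
        rw [← MvPolynomial.algebraMap_eq]
        exact (IsScalarTower.algebraMap_apply k (MvPolynomial (Fin n) k) L₂ r).symm
      rw [h, AlgHom.commutes, sub_self]; exact dvd_zero _
    | add p q hp hq =>
      have e : τ (ι₂ (p + q)) - ι₂ (p + q) = (τ (ι₂ p) - ι₂ p) + (τ (ι₂ q) - ι₂ q) := by
        rw [map_add (algebraMap (MvPolynomial (Fin n) k) L₂), map_add τ]; ring
      rw [e]; exact dvd_add hp hq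
    | mul_X p i hp =>
      have e : τ (ι₂ (p * X i)) - ι₂ (p * X i) =
          τ (ι₂ p) * (τ (ι₂ (X i)) - ι₂ (X i)) + (τ (ι₂ p) - ι₂ p) * ι₂ (X i) := by
        rw [map_mul (algebraMap (MvPolynomial (Fin n) k) L₂), map_mul τ]; ring
      rw [e]; exact dvd_add (dvd_mul_of_dvd_right (dX i) _) (dvd_mul_of_dvd_left hp _)
  -- `L₂`: `y = ι r · J ^ m`
  obtain ⟨⟨r, ⟨s, ⟨m, rfl⟩⟩⟩, hy⟩ := IsLocalization.surj (Submonoid.powers u₂) y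
  have hy' : y = ι₂ r * J₂ ^ m := by
    have e : y = y * (ι₂ u₂ * J₂) ^ m := by rw [h1, one_pow, mul_one]
    rw [e, mul_pow, ← mul_assoc, ← map_pow]
    exact congrArg (· * J₂ ^ m) hy
  have e : τ y - y = (τ (ι₂ r) - ι₂ r) * τ J₂ ^ m + ι₂ r * (τ J₂ ^ m - J₂ ^ m) := by
    rw [hy', map_mul τ, map_pow τ]; ring
  rw [e]
  exact dvd_add (dvd_mul_of_dvd_left (dP r) _)
    (dvd_mul_of_dvd_right (dvd_trans dJ (sub_dvd_pow_sub_pow _ _ m)) _)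

/-! ## The augmentation ideal is locally `(s³)` -/

-- the case analysis at a prime runs over the long law binders; head-room
set_option maxHeartbeats 3200000 in
/-- **At every prime `𝔮` of `L₂`, the image of the augmentation ideal `⟨σ̃y − y : y⟩` in `(L₂)_𝔮` is the
principal ideal generated by `s³`** (so it is `⊤` off `V(s)`); in particular the hypothesis `hdiv` of the
tree's K–L theorem `isRegularRing_fixedPoints_zpowers` holds (even without assuming `𝔮` fixed).
[OURS · L1 W4.5c] -/
theorem terminalLift_map_augIdeal_isPrincipal [CharP k 3] (σt : L₂ ≃ₐ[k] L₂)
    (hC : σt (ι₂ (X c)) = ι₂ (X c * v₂)) (hA : σt (ι₂ (X a)) = ι₂ (X a) * iv₂ ^ 7)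
    (hB : σt (ι₂ (X b)) = ι₂ (X b + X c ^ 3 * X a) * iv₂ ^ 4)
    (hD : σt (ι₂ (X d)) = ι₂ (X d + X c ^ 3 - X c ^ 15 * X a ^ 2))
    (hfix : ∀ i, i ≠ a → i ≠ b → i ≠ c → i ≠ d → σt (ι₂ (X i)) = ι₂ (X i))
    (𝔮 : Ideal L₂) [𝔮.IsPrime] :
    ((Ideal.span (Set.range fun y : L₂ => σt y - y)).map
      (algebraMap L₂ (Localization.AtPrime 𝔮))).IsPrincipal := by
  classical
  let τ : L₂ →ₐ[k] L₂ := σt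
  have hτ : ∀ y, τ y = σt y := fun _ => rfl
  have hiv := one_sub_iv k n a b c
  have hV := algebraMap_v_eq k n a b c
  have hBA := algebraMap_bshift_eq k n a b c
  have e4 := algebraMap_v_pow_mul_iv_pow k n a b c 4
  set I : Ideal L₂ := Ideal.span (Set.range fun y : L₂ => σt y - y) with hI
  let φ := algebraMap L₂ (Localization.AtPrime 𝔮)
  have hmemI : ∀ y, σt y - y ∈ I := fun y => Ideal.subset_span ⟨y, rfl⟩
  -- the three candidate units `θ` with `s³ θ ∈ I`
  have hDI : ι₂ (X c) ^ 3 * (1 - ι₂ (X c) ^ 12 * ι₂ (X a) ^ 2) ∈ I := by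
    have e : σt (ι₂ (X d)) - ι₂ (X d) = ι₂ (X c) ^ 3 * (1 - ι₂ (X c) ^ 12 * ι₂ (X a) ^ 2) := by
      rw [hD, map_sub (algebraMap _ _), map_add (algebraMap _ _)]
      simp only [map_mul, map_pow]
      ring
    rw [← e]; exact hmemI _
  have hCI : ι₂ (X c) ^ 3 * (ι₂ (X c) * ι₂ (X b)) ∈ I := by
    have e : σt (ι₂ (X c)) - ι₂ (X c) = ι₂ (X c) ^ 3 * (ι₂ (X c) * ι₂ (X b)) := by
      rw [hC, map_mul, hV]; ring
    rw [← e]; exact hmemI _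
  have hBI : ι₂ (X c) ^ 3 * (ι₂ (X a) * iv₂ ^ 4 - ι₂ (X b) ^ 2 * iv₂ * (iv₂ ^ 3 + iv₂ ^ 2 + iv₂ + 1))
      ∈ I := by
    have e : σt (ι₂ (X b)) - ι₂ (X b) =
        ι₂ (X c) ^ 3 * (ι₂ (X a) * iv₂ ^ 4 - ι₂ (X b) ^ 2 * iv₂ * (iv₂ ^ 3 + iv₂ ^ 2 + iv₂ + 1)) := by
      rw [hB, hBA]
      linear_combination (-(ι₂ (X b) * (iv₂ ^ 3 + iv₂ ^ 2 + iv₂ + 1))) * hiv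
    rw [← e]; exact hmemI _
  -- one of them is not in `𝔮`
  have hθ : ∃ θ : L₂, ι₂ (X c) ^ 3 * θ ∈ I ∧ θ ∉ 𝔮 := by
    by_cases hDq : 1 - ι₂ (X c) ^ 12 * ι₂ (X a) ^ 2 ∈ 𝔮
    swap
    · exact ⟨_, hDI, hDq⟩
    -- `θ_d ∈ 𝔮` forces `s ∉ 𝔮` and `x_a′ ∉ 𝔮`
    have hCq : ι₂ (X c) ∉ 𝔮 := by
      intro h
      have : (1 : L₂) ∈ 𝔮 := by
        have e : (1 : L₂) = (1 - ι₂ (X c) ^ 12 * ι₂ (X a) ^ 2) +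
            ι₂ (X c) * (ι₂ (X c) ^ 11 * ι₂ (X a) ^ 2) := by ring
        rw [e]; exact 𝔮.add_mem hDq (𝔮.mul_mem_right _ h)
      exact (Ideal.IsPrime.ne_top ‹_›) ((Ideal.eq_top_iff_one _).mpr this)
    have hAq : ι₂ (X a) ∉ 𝔮 := by
      intro h
      have : (1 : L₂) ∈ 𝔮 := by
        have e : (1 : L₂) = (1 - ι₂ (X c) ^ 12 * ι₂ (X a) ^ 2) +
            ι₂ (X a) * (ι₂ (X c) ^ 12 * ι₂ (X a)) := by ring
        rw [e]; exact 𝔮.add_mem hDq (𝔮.mul_mem_right _ h)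
      exact (Ideal.IsPrime.ne_top ‹_›) ((Ideal.eq_top_iff_one _).mpr this)
    by_cases hBq : ι₂ (X b) ∈ 𝔮
    · -- the `x_b′`-increment cofactor is a unit at `𝔮`
      refine ⟨_, hBI, fun h => hAq ?_⟩
      have h2 : ι₂ (X a) * iv₂ ^ 4 ∈ 𝔮 := by
        have hX : ι₂ (X b) ^ 2 * iv₂ * (iv₂ ^ 3 + iv₂ ^ 2 + iv₂ + 1) ∈ 𝔮 :=
          𝔮.mul_mem_right _ (𝔮.mul_mem_right _ (𝔮.pow_mem_of_mem hBq 2 two_pos))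
        have e := sub_add_cancel (ι₂ (X a) * iv₂ ^ 4)
          (ι₂ (X b) ^ 2 * iv₂ * (iv₂ ^ 3 + iv₂ ^ 2 + iv₂ + 1))
        rw [← e]; exact 𝔮.add_mem h hX
      have e : ι₂ (X a) = ι₂ (X a) * iv₂ ^ 4 * ι₂ v₂ ^ 4 := by
        linear_combination (-(ι₂ (X a))) * e4
      rw [e]; exact 𝔮.mul_mem_right _ h2
    · refine ⟨_, hCI, fun h => ?_⟩
      rcases Ideal.IsPrime.mem_or_mem ‹_› h with h | h
      · exact hCq h
      · exact hBq h
  obtain ⟨θ, hθI, hθq⟩ := hθ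
  have hS3 : φ (ι₂ (X c) ^ 3) ∈ I.map φ := by
    have hu : IsUnit (φ θ) :=
      (IsLocalization.AtPrime.isUnit_to_map_iff (Localization.AtPrime 𝔮) 𝔮 _).mpr hθq
    obtain ⟨w, hw⟩ := hu.exists_right_inv
    have hm := Ideal.mem_map_of_mem φ hθI
    rw [map_mul] at hm
    have := Ideal.mul_mem_right w _ hm
    rwa [mul_assoc, hw, mul_one] at this
  refine ⟨⟨φ (ι₂ (X c) ^ 3), le_antisymm ?_ ?_⟩⟩
  · -- `I.map φ ≤ (φ s³)`: every `σ̃ y − y` is a multiple of `s³`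
    rw [Ideal.map_le_iff_le_comap, hI, Ideal.span_le]
    rintro _ ⟨y, rfl⟩
    obtain ⟨w, hw⟩ := C_cube_dvd_terminalLift_sub k n a b c d τ hC hA hB hD hfix y
    show φ (σt y - y) ∈ Ideal.span {φ (ι₂ (X c) ^ 3)}
    rw [← hτ, hw, map_mul]
    exact Ideal.mul_mem_right _ _ (Ideal.mem_span_singleton_self _)
  · rw [Ideal.submodule_span_eq, Ideal.span_singleton_le_iff_mem]
    exact hS3

set_option maxHeartbeats 1600000 in
/-- **K–L on the terminal chart**: for the peeled `σ̄` (char 3) and ANY lift `σ̃ : L₂ ≃ₐ[k] L₂` with the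
terminal-lift laws and `σ̃ ^ 3 = 1` (one exists: `exists_terminalLift`), the invariant ring
`L₂^{σ̃} = FixedPoints.subalgebra k L₂ (zpowers σ̃)` is REGULAR. [OURS · L1 W4.5c]
[cite: KiralyLutkebohmert2013, Thm 2 (via the tree's `isRegularRing_fixedPoints_zpowers`)] -/
theorem terminalLift_fixedPoints_isRegularRing [CharP k 3] (σt : L₂ ≃ₐ[k] L₂)
    (hC : σt (ι₂ (X c)) = ι₂ (X c * v₂)) (hA : σt (ι₂ (X a)) = ι₂ (X a) * iv₂ ^ 7)
    (hB : σt (ι₂ (X b)) = ι₂ (X b + X c ^ 3 * X a) * iv₂ ^ 4)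
    (hD : σt (ι₂ (X d)) = ι₂ (X d + X c ^ 3 - X c ^ 15 * X a ^ 2))
    (hfix : ∀ i, i ≠ a → i ≠ b → i ≠ c → i ≠ d → σt (ι₂ (X i)) = ι₂ (X i)) (hσt3 : σt ^ 3 = 1) :
    IsRegularRing (FixedPoints.subalgebra k L₂ (Subgroup.zpowers σt)) := by
  classical
  haveI : IsDomain L₂ := isDomain_L₂ k n a b c
  haveI : IsRegularRing L₂ :=
    Literature.AlgebraicGeometry.Resolution.isRegularRing_localization (Submonoid.powers u₂)
  haveI : Algebra.FiniteType (MvPolynomial (Fin n) k) L₂ :=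
    IsLocalization.finiteType_of_monoid_fg (Submonoid.powers u₂) L₂
  haveI : Algebra.FiniteType k L₂ := Algebra.FiniteType.trans (S := MvPolynomial (Fin n) k)
    inferInstance inferInstance
  exact TameTransfer.isRegularRing_fixedPoints_zpowers Nat.prime_three σt
    (terminalLift_ne_one k n a b c σt hC) hσt3
    (fun 𝔮 _ _ => terminalLift_map_augIdeal_isPrincipal k n a b c d σt hC hA hB hD hfix 𝔮)

end Summit.ResolutionOfSingularities.ResolutionOfSingularities.Theorems.WildQuotientResolution.Z9Peeled.Terminal

end
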